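import Literature.InformationTheory.QuantumCodes.PlanarCodeCrossingPaths
import Literature.InformationTheory.QuantumCodes.CSSPhenomenologicalThreshold
import HarnessLib

/-!
# The space-time lift of the planar surface code under noisy syndrome measurement: fault locations as bonds of `ℤ³`,
# incidence = geometry, and the hand-shaking lemma (an odd rough crossing of a space-time cycle reaches the top rough face)

Topic `Literature/InformationTheory/QuantumCodes` (venture QEC, LADDER-QEC rung Q5, PARTITION row 09 "phenomenological";
qec-type-09 gen 6, cell item 09.PSAW (C)). All PROVED, kernel axioms, no named fact. The `T`-round memory experiment of
the `H_X`-sector of the `k`-th planar surface code is lit-2's generic space-time code (`CSSPhenomenologicalThreshold.lean`: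
histories `CSSPhenom.History`, boundary matrix `CSSPhenom.stMatrix (planarHX k) T`, projection `CSSPhenom.proj`). Following
Dennis–Kitaev–Landahl–Preskill §4.2 ("it is quite convenient to envision a three-dimensional simple cubic lattice, with
the third dimension representing an integer-valued time"; "Errors on horizontal links occur with probability p, and errors
on vertical links occur with probability q") we draw it in `ℤ³`: the space-time check
`((a, b), τ)` at the site `spv a b τ = (a, b, τ)`; the qubit fault `(q, t)` is the planar bond of `q` at height `t`
(`stBond`, dangling BELOW the patch — first coordinate `-1` — for the bottom rough qubits `(0, b)_L` and ABOVE it —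
`k + 1` — for the top rough qubits `(k+1, b)_L`); the measurement fault `(c, t)` is the vertical bond from `(c, t)` to
`(c, t+1)`.

* `stMatrix_planar_apply_eq_ite` — **incidence is geometry**: `stMatrix (planarHX k) T x ℓ = 1` iff the site of `x` is an
  end of the bond of `ℓ`; `stBond_injective`; the two ends of a bond are adjacent in `ℤ³` (`zdGraph_adj_of_stBond_eq`);
* `stLift Er` — the bond configuration of `ℤ³` opened by a set of fault locations;
* ★ `st_exists_reachable_top_of_odd` — **the hand-shaking lemma in space-time**: if `C` is a space-time cycle
  (`stMatrix (planarHX k) T *ᵥ C = 0`) supported in `Er` whose projection crosses the bottom rough boundary an odd number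
  of times (`Σ_b Π(C)(0,b)_L = 1` — as the residual of every failed memory experiment does, one encoded qubit), then some
  bottom rough site `(-1, b₀, t₀)` is joined through bonds of `Er` to some top rough site `(k+1, b₁, t₁)`. (Proof: sum
  the vanishing syndrome over the checks reachable from the bottom face; an open bond between two checks contributes
  `0` or `2`, a bottom dangling one `1`, a top dangling one `0` unless the top is reachable.) The `T = 1`-free, `q = 0`
  shadow of this lemma is type-03's `PlanarCode.exists_reachable_top_of_odd`.

The extraction of a rough-to-rough self-avoiding space-time path, its counting and the DKLP bound (eq. (fail_iso), relative
version) are `PlanarCodeSpaceTimePaths.lean` / `PlanarCodeSpaceTimePathsBound.lean`.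

## References

* [DennisEtAl2002] E. Dennis, A. Kitaev, A. Landahl, J. Preskill, *Topological quantum memory*, J. Math. Phys. 43 (2002)
  4452–4505, arXiv:quant-ph/0110143, §3.2 (planar codes, rough edges), §4.2 (the space-time lattice: horizontal and
  vertical links, error history), §4.3 (syndrome = boundary), §5.3 (relative polygons of the planar code).
* [DumerKovalevPryadko2015] I. Dumer, A. A. Kovalev, L. P. Pryadko, PRL 115 (2015) 050502, p. 5 (repetition code in time).
-/

namespace Literature.InformationTheory.QuantumCodes

namespace PlanarCode

open Finset Matrix CSSPhenom
open Literature.Probability.LatticeModels (Site zdGraph zdGraph_adj_iff)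
open Literature.Probability.Percolation (BondConfig openGraph openGraph_adj)
open Literature.Probability.RandomPlanarGeometry.SAW.Zd (zdGraph_adj_iff_sub)

variable {k T : ℕ}

/-! ### Space-time sites and bonds -/

/-- The `ℤ³` site `(a, b, τ)` of the space-time check `((a, b), τ)` (also used, with `a = -1` / `a = k+1`, for the virtual
sites below / above the rough edges). [cite: DennisEtAl2002, §4.2 (vertices of the space-time cubic lattice)] -/
def spv (a b τ : ℤ) : Site 3 := ![a, b, τ]

/-- Space-time sites are determined by their coordinates. [folklore] -/
private theorem spv_eq_spv_iff {a b τ a' b' τ' : ℤ} : spv a b τ = spv a' b' τ' ↔ a = a' ∧ b = b' ∧ τ = τ' := by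
  refine ⟨fun h => ?_, by rintro ⟨rfl, rfl, rfl⟩; rfl⟩
  exact ⟨by simpa [spv] using congrFun h 0, by simpa [spv] using congrFun h 1, by simpa [spv] using congrFun h 2⟩

/-- The site of a space-time check. [cite: DennisEtAl2002, §4.2 (vertices of the space-time lattice)] -/
def csite (x : PlanarCheck k × Fin (T + 1)) : Site 3 := spv x.1.1 x.1.2 x.2

/-- Distinct space-time checks have distinct sites. [cite: DennisEtAl2002, §4.2] -/
theorem csite_injective : Function.Injective (csite (k := k) (T := T)) := by
  rintro ⟨⟨a, b⟩, τ⟩ ⟨⟨a', b'⟩, τ'⟩ h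
  simp only [csite, spv_eq_spv_iff, Prod.mk.injEq, Fin.ext_iff] at h ⊢
  omega

/-- **The `ℤ³` bond of a fault location**: the qubit fault `(q, t)` is the planar bond of `q` drawn at height `t` (left qubit
`(α, b)`: `{(α-1, b, t), (α, b, t)}`; right qubit `(a, β)`: `{(a, β, t), (a, β+1, t)}`), the measurement fault `((a,b), t)` is
the vertical bond `{(a, b, t), (a, b, t+1)}`. [cite: DennisEtAl2002, §4.2 (horizontal links = qubit errors, vertical links = measurement errors)] -/
def stBond : HistoryLoc (PlanarQubit k) (PlanarCheck k) T → Sym2 (Site 3) :=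
  Sum.elim
    (fun qt => Sum.elim
      (fun αb : Fin (k + 2) × Fin (k + 2) => s(spv (((αb.1 : ℕ) : ℤ) - 1) αb.2 qt.2, spv αb.1 αb.2 qt.2))
      (fun aβ : Fin (k + 1) × Fin (k + 1) => s(spv aβ.1 aβ.2 qt.2, spv aβ.1 (((aβ.2 : ℕ) : ℤ) + 1) qt.2)) qt.1)
    (fun ct => s(spv ct.1.1 ct.1.2 ct.2, spv ct.1.1 ct.1.2 (((ct.2 : ℕ) : ℤ) + 1)))

/-- Advancing a site by a unit vector of `ℤ³`. [folklore] -/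
private theorem spv_add_single (a b τ : ℤ) :
    spv a b τ + Pi.single 0 1 = spv (a + 1) b τ ∧ spv a b τ + Pi.single 1 1 = spv a (b + 1) τ ∧
      spv a b τ + Pi.single 2 1 = spv a b (τ + 1) := by
  refine ⟨?_, ?_, ?_⟩ <;> funext j <;> fin_cases j <;> simp [spv]

/-- **The two ends of the bond of a fault location are adjacent sites of `ℤ³`.**
[cite: DennisEtAl2002, §4.2 (links of the simple cubic lattice)] -/
theorem zdGraph_adj_of_stBond_eq (ℓ : HistoryLoc (PlanarQubit k) (PlanarCheck k) T) {P P' : Site 3}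
    (h : stBond ℓ = s(P, P')) : (zdGraph 3).Adj P P' := by
  have key : ∀ (a b τ : ℤ) (i : Fin 3), (zdGraph 3).Adj (spv a b τ) (spv a b τ + Pi.single i 1) := by
    intro a b τ i
    rw [zdGraph_adj_iff_sub]
    exact ⟨i, Or.inl (by simp)⟩
  have fin : ∀ {A B : Site 3}, (zdGraph 3).Adj A B → s(A, B) = s(P, P') → (zdGraph 3).Adj P P' := by
    intro A B hAB hs
    rcases Sym2.eq_iff.1 hs with ⟨rfl, rfl⟩ | ⟨rfl, rfl⟩
    · exact hAB
    · exact hAB.symm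
  rcases ℓ with ⟨⟨α, b⟩ | ⟨a, β⟩, t⟩ | ⟨⟨a, b⟩, t⟩
  · have hA := key (((α : ℕ) : ℤ) - 1) b t 0
    rw [(spv_add_single _ _ _).1, sub_add_cancel] at hA
    exact fin hA h
  · have hA := key a β t 1
    rw [(spv_add_single _ _ _).2.1] at hA
    exact fin hA h
  · have hA := key a b t 2
    rw [(spv_add_single _ _ _).2.2] at hA
    exact fin hA h

/-- **The bond map is injective**: a fault location is determined by its space-time bond.
[cite: DennisEtAl2002, §4.2 (links of the space-time lattice)] -/
theorem stBond_injective : Function.Injective (stBond (k := k) (T := T)) := by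
  rintro (⟨⟨α, b⟩ | ⟨a, β⟩, t⟩ | ⟨⟨a, b⟩, t⟩) (⟨⟨α', b'⟩ | ⟨a', β'⟩, t'⟩ | ⟨⟨a', b'⟩, t'⟩) h <;>
    simp only [stBond, Sum.elim_inl, Sum.elim_inr, Sym2.eq_iff, spv_eq_spv_iff, Sum.inl.injEq, Sum.inr.injEq,
      Prod.mk.injEq, Fin.ext_iff, reduceCtorEq] at h ⊢ <;> omega

/-! ### Incidence is geometry -/

/-- **`stMatrix (planarHX k) T x ℓ = [the site of x is an end of the bond of ℓ]`**: the space-time check `((a,b), τ)` sees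
the qubit fault `(q, t)` iff `τ = t` and the vertex `(a, b)` is an end of the planar bond of `q`, and the measurement fault
`(c, t)` iff `c = (a, b)` and `τ ∈ {t, t+1}`. [cite: DennisEtAl2002, §4.2–4.3 (boundary of horizontal and vertical links)] -/
theorem stMatrix_planar_apply_eq_ite (x : PlanarCheck k × Fin (T + 1)) (ℓ : HistoryLoc (PlanarQubit k) (PlanarCheck k) T) :
    stMatrix (planarHX k) T x ℓ = if csite x ∈ stBond ℓ then 1 else 0 := by
  classical
  obtain ⟨⟨a, b⟩, τ⟩ := x
  rcases ℓ with ⟨⟨α, b'⟩ | ⟨a', β⟩, t⟩ | ⟨⟨a', b'⟩, t⟩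
  · have key : csite ((a, b), τ) ∈ stBond (Sum.inl (Sum.inl (α, b'), t) : HistoryLoc (PlanarQubit k) (PlanarCheck k) T)
        ↔ τ = t.castSucc ∧ ((α = a.castSucc ∨ α = a.succ) ∧ b = b') := by
      simp only [csite, stBond, Sum.elim_inl, Sym2.mem_iff, spv_eq_spv_iff, Fin.ext_iff, Fin.val_castSucc,
        Fin.val_succ]
      omega
    simp only [stMatrix, Matrix.of_apply, Sum.elim_inl, planarHX, HypergraphProduct.xMatrix_apply_inl, repMatrix,
      key]
    by_cases h1 : τ = t.castSucc <;> by_cases h2 : (α = a.castSucc ∨ α = a.succ) <;> by_cases h3 : b = b' <;>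
      simp [h1, h2, h3]
  · have key : csite ((a, b), τ) ∈ stBond (Sum.inl (Sum.inr (a', β), t) : HistoryLoc (PlanarQubit k) (PlanarCheck k) T)
        ↔ τ = t.castSucc ∧ (a = a' ∧ (b = β.castSucc ∨ b = β.succ)) := by
      simp only [csite, stBond, Sum.elim_inl, Sum.elim_inr, Sym2.mem_iff, spv_eq_spv_iff, Fin.ext_iff,
        Fin.val_castSucc, Fin.val_succ]
      omega
    simp only [stMatrix, Matrix.of_apply, Sum.elim_inl, planarHX, HypergraphProduct.xMatrix_apply_inr, repMatrix,
      Matrix.transpose_apply, key]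
    by_cases h1 : τ = t.castSucc <;> by_cases h2 : a = a' <;> by_cases h3 : (b = β.castSucc ∨ b = β.succ) <;>
      simp [h1, h2, h3]
  · have key : csite ((a, b), τ) ∈ stBond (Sum.inr ((a', b'), t) : HistoryLoc (PlanarQubit k) (PlanarCheck k) T)
        ↔ (a, b) = (a', b') ∧ (τ = t.castSucc ∨ τ = t.succ) := by
      simp only [csite, stBond, Sum.elim_inr, Sym2.mem_iff, spv_eq_spv_iff, Fin.ext_iff, Fin.val_castSucc,
        Fin.val_succ, Prod.mk.injEq]
      omega
    simp only [stMatrix, Matrix.of_apply, Sum.elim_inr, key]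

/-- **The space-time syndrome is the parity of the history on the bonds at that site**:
`(stMatrix H T *ᵥ E) x = Σ_{ℓ : site(x) ∈ bond(ℓ)} E(ℓ)`. [cite: DennisEtAl2002, §4.3 (syndrome = boundary of the error chain)] -/
theorem stMatrix_planar_mulVec_apply_eq_sum (E : History (PlanarCheck k) (PlanarQubit k) T)
    (x : PlanarCheck k × Fin (T + 1)) :
    (stMatrix (planarHX k) T *ᵥ E) x = ∑ ℓ, if csite x ∈ stBond ℓ then E ℓ else 0 := by
  classical
  simp only [mulVec, dotProduct, stMatrix_planar_apply_eq_ite]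
  exact Finset.sum_congr rfl fun ℓ _ => by split_ifs <;> simp

/-! ### The lift and the hand-shaking lemma -/

/-- **The space-time lift** of a set of fault locations: the bond configuration of `ℤ³` whose open bonds are their bonds.
[cite: DennisEtAl2002, §4.2 (the error chain E as links of the space-time lattice)] -/
def stLift (Er : Finset (HistoryLoc (PlanarQubit k) (PlanarCheck k) T)) : BondConfig (Site 3) :=
  {e | ∃ ℓ ∈ Er, stBond ℓ = e}

/-- A fault location of `Er` opens its bond. [cite: DennisEtAl2002, §4.2] -/
theorem stLift_adj_of_mem {Er : Finset (HistoryLoc (PlanarQubit k) (PlanarCheck k) T)}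
    {ℓ : HistoryLoc (PlanarQubit k) (PlanarCheck k) T} (hℓ : ℓ ∈ Er) {P P' : Site 3} (h : stBond ℓ = s(P, P')) :
    (openGraph (stLift Er)).Adj P P' := by
  rw [openGraph_adj]
  exact ⟨⟨ℓ, hℓ, h⟩, (zdGraph_adj_of_stBond_eq ℓ h).ne⟩

/-- In `ℤ₂`, the indicator of membership in a genuine pair is the sum of the two point indicators. [folklore] -/
private theorem ite_mem_sym2_eq_add {P A B : Site 3} (hAB : A ≠ B) :
    (if P ∈ s(A, B) then (1 : ZMod 2) else 0) = (if P = A then 1 else 0) + (if P = B then 1 else 0) := by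
  classical
  simp only [Sym2.mem_iff]
  by_cases hA : P = A
  · have hB : P ≠ B := fun h => hAB (hA.symm.trans h)
    rw [if_pos (Or.inl hA), if_pos hA, if_neg hB, add_zero]
  · by_cases hB : P = B
    · rw [if_pos (Or.inr hB), if_neg hA, if_pos hB, zero_add]
    · rw [if_neg (not_or.2 ⟨hA, hB⟩), if_neg hA, if_neg hB, add_zero]

/-- ★ **The hand-shaking lemma in space-time: an odd bottom rough crossing reaches the top rough face.** Let `C` be a
space-time cycle of the `T`-round memory experiment of the `H_X`-sector of the `k`-th planar code
(`stMatrix (planarHX k) T *ᵥ C = 0`) supported in the fault set `Er`, whose projection `Π(C)` crosses the bottom rough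
boundary an odd number of times (`Σ_b Π(C)(0, b)_L = 1`). Then some bottom rough site `(-1, b₀, t₀)` is joined, through
bonds of `Er`, to some top rough site `(k+1, b₁, t₁)`. (Sum the vanishing syndrome over the checks reachable from the
bottom face: each open bond between two checks contributes `0` or `2`, each bottom dangling bond `1`, each top dangling
bond `0` — unless the top face is reachable.) [cite: DennisEtAl2002, §4.2–4.3 and §5.3 (relative polygons ending on the boundary)] -/
theorem st_exists_reachable_top_of_odd {Er : Finset (HistoryLoc (PlanarQubit k) (PlanarCheck k) T)}
    {C : History (PlanarCheck k) (PlanarQubit k) T} (hC : stMatrix (planarHX k) T *ᵥ C = 0)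
    (hCE : ∀ ℓ, C ℓ ≠ 0 → ℓ ∈ Er) (hodd : ∑ b : Fin (k + 2), proj C (Sum.inl (0, b)) = 1) :
    ∃ (b₀ : Fin (k + 2)) (t₀ : Fin T) (b₁ : Fin (k + 2)) (t₁ : Fin T),
      (openGraph (stLift Er)).Reachable (spv (-1) b₀ t₀) (spv ((k : ℤ) + 1) b₁ t₁) := by
  classical
  by_contra hno
  push Not at hno
  set G := openGraph (stLift Er) with hG
  -- `R P`: the site `P` is joined to the bottom rough face
  set R : Site 3 → Prop := fun P => ∃ (b₀ : Fin (k + 2)) (t₀ : Fin T), G.Reachable (spv (-1) b₀ t₀) P with hR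
  have hRadj : ∀ {P P' : Site 3}, G.Adj P P' → (R P ↔ R P') := fun h =>
    ⟨fun ⟨b₀, t₀, hr⟩ => ⟨b₀, t₀, hr.trans h.reachable⟩, fun ⟨b₀, t₀, hr⟩ => ⟨b₀, t₀, hr.trans h.symm.reachable⟩⟩
  set χ : PlanarCheck k × Fin (T + 1) → ZMod 2 := fun x => if R (csite x) then 1 else 0 with hχ
  -- `f P = Σ_x χ(x) [site x = P]`: `χ` of the check at `P`, or `0` at a virtual site
  set f : Site 3 → ZMod 2 := fun P => ∑ x, χ x * (if csite x = P then 1 else 0) with hf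
  have hf_site : ∀ x₀, f (csite x₀) = χ x₀ := by
    intro x₀
    simp only [hf]
    rw [Finset.sum_eq_single x₀]
    · simp
    · intro x _ hx
      rw [if_neg (fun h => hx (csite_injective h)), mul_zero]
    · intro h; exact absurd (Finset.mem_univ _) h
  have hf_virtual : ∀ P : Site 3, (∀ x : PlanarCheck k × Fin (T + 1), csite x ≠ P) → f P = 0 := by
    intro P hP
    simp only [hf]
    exact Finset.sum_eq_zero fun x _ => by rw [if_neg (hP x), mul_zero]
  have hbot_virtual : ∀ (b : Fin (k + 2)) (t : Fin T) (x : PlanarCheck k × Fin (T + 1)),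
      csite x ≠ spv (-1) b t := by
    rintro b t ⟨⟨a, b'⟩, τ⟩ h
    have h1 := (spv_eq_spv_iff.1 h).1
    omega
  have htop_virtual : ∀ (b : Fin (k + 2)) (t : Fin T) (x : PlanarCheck k × Fin (T + 1)),
      csite x ≠ spv ((k : ℤ) + 1) b t := by
    rintro b t ⟨⟨a, b'⟩, τ⟩ h
    have h1 := (spv_eq_spv_iff.1 h).1
    have h2 := a.2
    omega
  -- `g ℓ = Σ_x χ(x) M(x, ℓ) = f(P₁) + f(P₂)` for the bond `{P₁, P₂}` of `ℓ`
  have hg : ∀ (ℓ : HistoryLoc (PlanarQubit k) (PlanarCheck k) T) {P₁ P₂ : Site 3}, stBond ℓ = s(P₁, P₂) →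
      ∑ x, χ x * stMatrix (planarHX k) T x ℓ = f P₁ + f P₂ := by
    intro ℓ P₁ P₂ hℓ
    have hne : P₁ ≠ P₂ := (zdGraph_adj_of_stBond_eq ℓ hℓ).ne
    simp only [hf, ← Finset.sum_add_distrib, ← mul_add]
    refine Finset.sum_congr rfl fun x _ => ?_
    rw [stMatrix_planar_apply_eq_ite, hℓ, ite_mem_sym2_eq_add hne]
  -- the bottom-dangling indicator
  set bot : HistoryLoc (PlanarQubit k) (PlanarCheck k) T → ZMod 2 := fun ℓ =>
    Sum.elim (fun qt => Sum.elim (fun αb : Fin (k + 2) × Fin (k + 2) => if αb.1 = 0 then 1 else 0)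
      (fun _ => 0) qt.1) (fun _ => 0) ℓ with hbot
  -- evaluation of `g` on the open bonds
  have hval : ∀ ℓ ∈ Er, ∑ x, χ x * stMatrix (planarHX k) T x ℓ = bot ℓ := by
    intro ℓ hℓ
    rcases ℓ with ⟨⟨α, b⟩ | ⟨a, β⟩, t⟩ | ⟨⟨a, b⟩, t⟩
    · -- left qubit `(α, b)` at height `t`: bond `{(α-1, b, t), (α, b, t)}`
      have hB : stBond (Sum.inl (Sum.inl (α, b), t) : HistoryLoc (PlanarQubit k) (PlanarCheck k) T) =
          s(spv (((α : ℕ) : ℤ) - 1) b t, spv α b t) := rfl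
      rw [hg _ hB]
      simp only [hbot, Sum.elim_inl]
      have hadj := stLift_adj_of_mem hℓ hB
      by_cases hα0 : α = 0
      · -- bottom dangling: `f(-1, b, t) = 0`, `f(0, b, t) = χ = 1`
        subst hα0
        rw [if_pos rfl]
        have h1 : f (spv (((((0 : Fin (k + 2)) : ℕ) : ℤ)) - 1) b t) = 0 := by
          refine hf_virtual _ fun x => ?_
          have := hbot_virtual b t x
          simpa using this
        have hx0 : csite (((0 : Fin (k + 1)), b), t.castSucc) = spv ((((0 : Fin (k + 2)) : ℕ) : ℤ)) b t := by
          simp [csite]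
        have h2 : f (spv ((((0 : Fin (k + 2)) : ℕ) : ℤ)) b t) = 1 := by
          rw [← hx0, hf_site, hχ]
          simp only
          rw [if_pos]
          refine (hRadj (hx0 ▸ hadj)).1 ⟨b, t, ?_⟩
          simp
        rw [h1, h2, zero_add]
      · rw [if_neg hα0]
        by_cases hαk : (α : ℕ) = k + 1
        · -- top dangling: `f(k+1, b, t) = 0`, and `f(k, b, t) = 0` since the top is not reachable
          have h2 : f (spv α b t) = 0 := by
            refine hf_virtual _ fun x => ?_
            have := htop_virtual b t x
            rwa [show ((k : ℤ) + 1) = ((α : ℕ) : ℤ) by omega] at this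
          have hxk : csite ((⟨k, by omega⟩, b), t.castSucc) = spv (((α : ℕ) : ℤ) - 1) b t := by
            simp [csite, hαk]
          have h1 : f (spv (((α : ℕ) : ℤ) - 1) b t) = 0 := by
            rw [← hxk, hf_site, hχ]
            simp only
            rw [if_neg]
            rintro hRk
            obtain ⟨b₀, t₀, hr⟩ := (hRadj (hxk ▸ hadj)).1 hRk
            refine hno b₀ t₀ b t ?_
            rwa [show ((k : ℤ) + 1) = ((α : ℕ) : ℤ) by omega]
          rw [h1, h2, add_zero]
        · -- interior vertical bond between the checks `(α-1, b)` and `(α, b)`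
          have hα1 : 1 ≤ (α : ℕ) := Nat.one_le_iff_ne_zero.2 fun h => hα0 (Fin.ext h)
          have hαle : (α : ℕ) ≤ k := by have := α.2; omega
          have hx1 : csite ((⟨(α : ℕ) - 1, by omega⟩, b), t.castSucc) = spv (((α : ℕ) : ℤ) - 1) b t := by
            simp [csite, spv_eq_spv_iff]; omega
          have hx2 : csite ((⟨(α : ℕ), by omega⟩, b), t.castSucc) = spv α b t := by
            simp [csite]
          rw [← hx1, ← hx2, hf_site, hf_site, hχ]
          simp only
          have hiff := hRadj (hx1 ▸ hx2 ▸ hadj)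
          by_cases hr : R (csite ((⟨(α : ℕ) - 1, by omega⟩, b), t.castSucc))
          · rw [if_pos hr, if_pos (hiff.1 hr)]; decide
          · rw [if_neg hr, if_neg (fun h => hr (hiff.2 h)), add_zero]
    · -- right qubit `(a, β)` at height `t`: horizontal bond between the checks `(a, β)` and `(a, β+1)`
      have hB : stBond (Sum.inl (Sum.inr (a, β), t) : HistoryLoc (PlanarQubit k) (PlanarCheck k) T) =
          s(spv a β t, spv a (((β : ℕ) : ℤ) + 1) t) := rfl
      rw [hg _ hB]
      simp only [hbot, Sum.elim_inl, Sum.elim_inr]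
      have hadj := stLift_adj_of_mem hℓ hB
      have hx1 : csite ((a, β.castSucc), t.castSucc) = spv a β t := by simp [csite]
      have hx2 : csite ((a, β.succ), t.castSucc) = spv a (((β : ℕ) : ℤ) + 1) t := by simp [csite, Fin.val_succ]
      rw [← hx1, ← hx2, hf_site, hf_site, hχ]
      simp only
      have hiff := hRadj (hx1 ▸ hx2 ▸ hadj)
      by_cases hr : R (csite ((a, β.castSucc), t.castSucc))
      · rw [if_pos hr, if_pos (hiff.1 hr)]; decide
      · rw [if_neg hr, if_neg (fun h => hr (hiff.2 h)), add_zero]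
    · -- measurement fault of the check `(a, b)` in round `t`: vertical bond `{(a, b, t), (a, b, t+1)}`
      have hB : stBond (Sum.inr ((a, b), t) : HistoryLoc (PlanarQubit k) (PlanarCheck k) T) =
          s(spv a b t, spv a b (((t : ℕ) : ℤ) + 1)) := rfl
      rw [hg _ hB]
      simp only [hbot, Sum.elim_inr]
      have hadj := stLift_adj_of_mem hℓ hB
      have hx1 : csite ((a, b), t.castSucc) = spv a b t := by simp [csite]
      have hx2 : csite ((a, b), t.succ) = spv a b (((t : ℕ) : ℤ) + 1) := by simp [csite, Fin.val_succ]
      rw [← hx1, ← hx2, hf_site, hf_site, hχ]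
      simp only
      have hiff := hRadj (hx1 ▸ hx2 ▸ hadj)
      by_cases hr : R (csite ((a, b), t.castSucc))
      · rw [if_pos hr, if_pos (hiff.1 hr)]; decide
      · rw [if_neg hr, if_neg (fun h => hr (hiff.2 h)), add_zero]
  -- (1) the total syndrome over the reachable checks vanishes; (2) swap the sums
  have h1 : ∑ x, χ x * (stMatrix (planarHX k) T *ᵥ C) x = 0 :=
    Finset.sum_eq_zero fun x _ => by rw [hC, Pi.zero_apply, mul_zero]
  have h2 : ∑ x, χ x * (stMatrix (planarHX k) T *ᵥ C) x = ∑ ℓ, C ℓ * ∑ x, χ x * stMatrix (planarHX k) T x ℓ := by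
    simp only [mulVec, dotProduct, Finset.mul_sum]
    rw [Finset.sum_comm]
    exact Finset.sum_congr rfl fun ℓ _ => Finset.sum_congr rfl fun x _ => by ring
  -- (3) only the bottom dangling bonds survive
  have h3 : ∑ ℓ, C ℓ * ∑ x, χ x * stMatrix (planarHX k) T x ℓ = ∑ ℓ, C ℓ * bot ℓ := by
    refine Finset.sum_congr rfl fun ℓ _ => ?_
    by_cases hC0 : C ℓ = 0
    · rw [hC0, zero_mul, zero_mul]
    · rw [hval ℓ (hCE ℓ hC0)]
  -- (4) and they add up to the bottom crossing number of the projection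
  have h4 : ∑ ℓ, C ℓ * bot ℓ = ∑ b : Fin (k + 2), proj C (Sum.inl (0, b)) := by
    simp only [hbot, Fintype.sum_sum_type, Sum.elim_inl, Sum.elim_inr, mul_zero, Finset.sum_const_zero, add_zero,
      Fintype.sum_prod_type, proj_apply]
    rw [Finset.sum_comm]
    refine Finset.sum_congr rfl fun b _ => ?_
    rw [Finset.sum_eq_single (0 : Fin (k + 2))]
    · simp
    · intro α _ hα
      simp [hα]
    · intro h; exact absurd (Finset.mem_univ _) h
  rw [h2, h3, h4, hodd] at h1
  exact one_ne_zero h1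

end PlanarCode

end Literature.InformationTheory.QuantumCodes
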